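import Summits.ResolutionOfSingularities.ResolutionOfSingularities.Theorems.WallAlgebra2
import HarnessLib

/-!
# WallTransport — decomp-res node «WallCut» (lens-4 g30, critic rows 176/176a CLEARED DECIDED +1), tree file 3/8 of the node

Content VERBATIM from the decomp-res lens-4 g30 node `HOME/decomp-res-lens-4/g30/WallCut.lean` (pin c43ccc48;
imports the landed tree only, carries nothing);
HOME = run/shared/lean/pub/decomp-res; critic rows 176/176a CLEARED DECIDED +1; landing orders INBOX :819 —
provenance, critic text and the lens header in full in the first file of the
node, `WallAlgebra`.  Namespace `…Theorems.HugValuationCut`; `--supports stmt-ResolutionOfSingularities-28338`.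

## This file

§82 (NEW, KERNEL) THE TWO-WALL PRESENTATION `TwoWallAt 𝓘 W V H e` (full regular system `(w,v,z)`, tail `f − c z² =
w·v·(u v^e + a w + b z)`, `c,u,a` units), ITS TRANSPORT THROUGH ONE POINT BLOW-UP — TICK `twoWall_point_transport`
(the wall exponent drops by exactly one at every marked class successor, dim ≤ 3), EXIT `twoWall_point_exit` (no
successor off the kept wall while `e ≥ 2`, nor lateral), and the dichotomy; the two transport theorems keep their
`set_option maxHeartbeats 800000 in` prefixes VERBATIM (continued `WallTransport2` where the 400-line cap cuts).
(This first part carries: `TwoWallAt`, `twoWall_point_transport`, `twoWall_point_exit`.)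

[WRITER NOTE (decomp-res writer g11): file split only (tree files ≤ 400 lines); namespace, universes, sections,
section variables and every declaration
exactly as in the lens (the node's global dupNamespace-linter line is dropped — the library sets it; the `open
…Theses` line lives only in the Theses-cone file;
`set_option maxHeartbeats … in` prefixes of single declarations are kept VERBATIM).  ONE deletion (gate dedup rule,
critic :835 watch-list): the node's private copy of
isUnit_add_of_mem_maximalIdeal` is NOT re-landed — it is LITERALLY the landed
`Literature.AlgebraicGeometry.Resolution.isUnit_add_of_mem_maximalIdeal` (`WeightedInitialTerms`,
imported; the namespace is opened as in the lens), which the transport proofs now cite by the same short name.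
SECOND deletion (gate dedup bounce p810318):
the node's `range_triple` is NOT re-landed — it is LITERALLY the landed
`…Cruxes.HypersurfaceCentreConstruction.LocalEngine.Iota3.range_vec₃`
(`Theorems/WeightedInvariantIota3FlagTools`, imported from `WallAlgebra2` on; aliased by an explicit `open …
(range_vec₃)`), cited by name at its two uses.]

(Sources: Hauser2010Kangaroo (arXiv:0811.4151, Kangaroo Theorem condition (3)); HauserPerlega2019 §2; Hauser2024
PRIMS 60; Moh1987; Perlega2023; Matsumura1987 Thms. 14.2–14.3, 19.x; ZariskiSamuel1960 VIII §11; StacksProject Tags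
0804, 0BIQ, 00NQ, 0AGS; DeJong1996 2.4; CossartPiltant2008 §2; Giraud1975.)
-/

noncomputable section

open CategoryTheory AlgebraicGeometry IsLocalRing
open Literature.AlgebraicGeometry.Resolution
open Summit.ResolutionOfSingularities.ResolutionOfSingularities.Theorems
open WeakOrderReduction ForcedTowerClasses DivergentTowerClasses MonomialTowerClasses
open HugDimensionClasses HugDimensionKernels SurfaceShadowClasses SurfaceShadowKernels
open NearPointCut (SingularClass)
open scoped BigOperators
open Summit.ResolutionOfSingularities.ResolutionOfSingularities.Cruxes.HypersurfaceCentreConstruction.LocalEngine.Iota3 (range_vec₃)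

namespace Summit.ResolutionOfSingularities.ResolutionOfSingularities.Theorems.HugValuationCut

section WallTransport

variable {X X' : Scheme.{0}} {π : X' ⟶ X} {C : X.IdealSheafData}

/-! ## §82 (g30 · NEW · KERNEL) THE TWO-WALL PRESENTATION `TwoWallAt 𝓘 W V H e`, ITS TRANSPORT THROUGH ONE POINT
BLOW-UP (the wall
exponent `e` DROPS BY ONE at a successor on the kept wall) AND ITS EXIT LAW (a successor off the kept wall has `e =
1` and is off
both walls) — characteristic 2, weight 2. -/

/-- **`TwoWallAt 𝓘 W V H e y` — THE TWO-WALL PRESENTATION with WALL EXPONENT `e`** (NEW TYPED PREDICATE, weight 2).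
At `y`: a FULL regular system of parameters `(w, v, z)` of `𝒪_y` with `W_y = (w)` (the KEPT WALL), `V_y = (v)` (the OTHER WALL)
and `H_y = (z)` (the contact germ), and an element `f ∈ 𝓘_y` with `f − c·z² = w·v·g`, `c` a unit — the tail is divisible
by the TWO walls `w`, `v` — whose cofactor has the NORMAL FORM `g = u·v^e + a·w + b·z` with `u` AND `a` units and `e
≥ 1`: along the curve `W ∩ H =
V(w, z)` the cofactor has order exactly `e` (the WALL EXPONENT of `W`), along `V(v, z)` it has order exactly `1`.
DEFINITION (support). -/
def TwoWallAt {Y : Scheme.{0}} (I W V H : Y.IdealSheafData) (e : ℕ) (y : Y) : Prop :=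
  ∃ w v z : Y.presheaf.stalk y,
    stalkIdeal W y = Ideal.span {w} ∧ stalkIdeal V y = Ideal.span {v} ∧ stalkIdeal H y = Ideal.span {z} ∧
    IsRsopPart ![w, v, z] ∧ Ideal.span {w, v, z} = maximalIdeal (Y.presheaf.stalk y) ∧
    ∃ f ∈ stalkIdeal I y, ∃ c g : Y.presheaf.stalk y, IsUnit c ∧ f - c * z ^ 2 = w * v * g ∧
      ∃ u a b : Y.presheaf.stalk y, IsUnit u ∧ IsUnit a ∧ 1 ≤ e ∧ g = u * v ^ e + a * w + b * z

set_option maxHeartbeats 800000 in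
/-- **THE WALL LAW THROUGH ONE POINT BLOW-UP (KERNEL, PROVED; characteristic 2, weight 2, ring dimension ≤ 3 upstairs).**
`TwoWallAt 𝓘 W V H e x`, `π` the blow-up of the reduced closed point `x`, `y` a point over `x` with `𝓘'_y ⊆ 𝔪_y²` (marked),
`𝓘'_y` of `2`-power form (the class letter), `dim 𝒪_y < 4`, and `y` ON THE WEAK TRANSFORM `W'` of the kept wall ⟹
`e ≥ 2` AND `TwoWallAt 𝓘' W' E H' (e − 1) y`: the kept wall stays the kept wall, the NEW exceptional divisor `E = (s)` becomes
the other wall, and THE WALL EXPONENT DROPS BY EXACTLY ONE.  PROOF: joint chart round (`point_round_chart_rsop₂`):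
`π^*w = s w₁`,
`π^*z = s z'`, `π^*v = s v₁`; fullness `𝔪_x = (w, v, z)` gives `(s) = (s w₁, s v₁, s z')`, so `1 ∈ (w₁, v₁, z')` and — as
`w₁, z' ∈ 𝔪_y` — `v₁` is a UNIT; the tail becomes `w₀ − π^*c·z'² = w₁·s·(v₁ g₁)` with `g₁ = π^*u v₁^e s^{e−1} + π^*a w₁ +
π^*b z'`, i.e. the normal form `(π^*u v₁^{e+1})·s^{e−1} + (π^*a v₁)·w₁ + (π^*b v₁)·z'` at `y` w.r.t. `(w₁, s, z')` (a full
system by `dim < 4`); if `e = 1` then `v₁ g₁` is a unit and `w₀ = π^*c z'² + s w₁·unit` is not a `2`-power form modulo `𝔪³`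
(EXIT LEMMA `not_mem_pPowerSpan_of_twoWall_unit` = LEMMA D on the letters `(s, w₁)`), contradicting the class letter.
(Sources: Hauser2010Kangaroo; Matsumura1987, Thms. 14.2–14.3; StacksProject, Tag 0BIQ.) -/
theorem twoWall_point_transport (hπ : IsBlowup π C) [IsLocallyNoetherian X] [IsLocallyNoetherian X']
    (hX : Scheme.IsRegular X) (hCreg : Scheme.IsRegular C.subscheme) (I W V H : X.IdealSheafData) {e : ℕ}
    (y : X') (hcl : IsClosed ({π y} : Set X)) (hpt : (C.support : Set X) = {π y})
    (hIn : stalkIdeal I (π y) ≤ maximalIdeal _ ^ 2)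
    (hI'2 : stalkIdeal (controlledTransform π C I 2) y ≤ maximalIdeal _ ^ 2)
    (hdim : ¬ (4 : WithBot ℕ∞) ≤ ringKrullDim (X'.presheaf.stalk y))
    [CharP (X'.presheaf.stalk y) 2] (hPP : PPowerFormAt 2 (controlledTransform π C I 2) 2 y)
    (h : TwoWallAt I W V H e (π y)) (hsat : y ∈ (controlledTransform π C W 1).support) :
    2 ≤ e ∧ TwoWallAt (controlledTransform π C I 2) (controlledTransform π C W 1) (C.comap π)
      (controlledTransform π C H 1) (e - 1) y := by
  obtain ⟨w, v, z, hWw, -, hHz, hrs, hfull, f, hfI, c, g, hc, hft, u, a, b, hu, ha, he, hg⟩ := h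
  obtain ⟨d, rfl⟩ : ∃ d, e = d + 1 := ⟨e - 1, by omega⟩
  haveI : IsRegularLocalRing (X.presheaf.stalk (π y)) := hX _
  have hCst : stalkIdeal C (π y) = maximalIdeal _ := by
    rw [eq_vanishingIdeal_support_of_isRegular C hCreg]
    apply stalkIdeal_vanishingIdeal_eq_maximalIdeal_of_closure_eq
    rw [hpt, hcl.closure_eq]
  have hrs_wz : IsRsopPart ![w, z] := isRsopPart_pair_of_triple hrs ![0, 2] (by decide)
  obtain ⟨𝔷, w₁, z', hE, hnzd, hww, hzz', hW', hH', hreg⟩ := point_round_chart_rsop₂ hπ y hCst hrs_wz hWw hHz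
  set σ := (π.stalkMap y).hom with hσ
  set s := σ 𝔷 with hs
  have hEm : (maximalIdeal (X.presheaf.stalk (π y))).map σ = Ideal.span {s} := by
    rw [← hCst, ← stalkIdeal_comap_eq_map_stalkMap, hE]
  have hmle : (maximalIdeal (X.presheaf.stalk (π y))).map σ ≤ maximalIdeal (X'.presheaf.stalk y) :=
    Ideal.map_le_iff_le_comap.mpr fun a ha => Ideal.mem_comap.mpr (map_nonunit σ a ha)
  have hsm : s ∈ maximalIdeal (X'.presheaf.stalk y) := hmle (by rw [hEm]; exact Ideal.mem_span_singleton_self s)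
  -- `π^* v = v₁ s`
  have hvm : v ∈ maximalIdeal (X.presheaf.stalk (π y)) := by simpa using hrs.mem_maximalIdeal 1
  have hσv : σ v ∈ Ideal.span {s} := by rw [← hEm]; exact Ideal.mem_map_of_mem _ hvm
  obtain ⟨v₁, hv₁⟩ := Ideal.mem_span_singleton'.mp hσv
  -- `π^* f = w₀ s²`, `w₀ ∈ 𝓘'_y`
  have hσf : σ f ∈ Ideal.span {s ^ 2} := by
    have hm : σ f ∈ (maximalIdeal _ ^ 2).map σ := Ideal.mem_map_of_mem _ (hIn hfI)
    rwa [Ideal.map_pow, hEm, Ideal.span_singleton_pow] at hm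
  obtain ⟨w₀, hw₀⟩ := Ideal.mem_span_singleton'.mp hσf
  have hI' : stalkIdeal (controlledTransform π C I 2) y =
      Submodule.colon ((stalkIdeal I (π y)).map σ) {s ^ 2} := by
    rw [hπ.stalkIdeal_controlledTransform I 2 y, stalkIdeal_comap_eq_map_stalkMap, hE,
      Ideal.span_singleton_pow, Submodule.colon_span]
  have hw₀I' : w₀ ∈ stalkIdeal (controlledTransform π C I 2) y := by
    rw [hI', Submodule.mem_colon_singleton, smul_eq_mul, hw₀]
    exact Ideal.mem_map_of_mem _ hfI
  -- the transported cofactor: `π^* g = s · g₁`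
  set g₁ : X'.presheaf.stalk y := σ u * v₁ ^ (d + 1) * s ^ d + σ a * w₁ + σ b * z' with hg₁
  have hσg : σ g = s * g₁ := by
    rw [hg]
    simp only [map_add, map_mul, map_pow]
    rw [← hv₁, hww, hzz', hg₁]
    ring
  -- cancel `s²`: the transported tail is `w₁ · s · (v₁ g₁)`
  have hkey : w₀ - σ c * z' ^ 2 = w₁ * s * (v₁ * g₁) := by
    have h1 : s ^ 2 * (w₀ - σ c * z' ^ 2) = s ^ 2 * (w₁ * s * (v₁ * g₁)) := by
      have e1 : σ (f - c * z ^ 2) = σ f - σ c * (s * z') ^ 2 := by rw [map_sub, map_mul, map_pow, hzz']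
      have e2 : σ (f - c * z ^ 2) = σ w * σ v * σ g := by rw [hft, map_mul, map_mul]
      calc s ^ 2 * (w₀ - σ c * z' ^ 2) = w₀ * s ^ 2 - σ c * (s * z') ^ 2 := by ring
        _ = σ (f - c * z ^ 2) := by rw [e1, hw₀]
        _ = σ w * σ v * σ g := e2
        _ = (s * w₁) * (v₁ * s) * (s * g₁) := by rw [hww, ← hv₁, hσg]
        _ = s ^ 2 * (w₁ * s * (v₁ * g₁)) := by ring
    exact (mul_cancel_left_mem_nonZeroDivisors (pow_mem hnzd 2)).mp h1
  -- `z' ∈ 𝔪_y` (the order did not drop)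
  have hcu : IsUnit (σ c) := hc.map σ
  have hI'1 : stalkIdeal (controlledTransform π C I 2) y ≤ maximalIdeal _ :=
    hI'2.trans (Ideal.pow_le_self (by norm_num))
  have hz'p : σ c * z' ^ 2 ∈ maximalIdeal (X'.presheaf.stalk y) := by
    have h1 : w₀ - w₁ * s * (v₁ * g₁) ∈ maximalIdeal _ :=
      sub_mem (hI'1 hw₀I') (Ideal.mul_mem_right _ _ (Ideal.mul_mem_left _ _ hsm))
    have e : w₀ - w₁ * s * (v₁ * g₁) = σ c * z' ^ 2 := by rw [← hkey]; ring
    rwa [e] at h1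
  have hz'm : z' ∈ maximalIdeal (X'.presheaf.stalk y) :=
    Ideal.IsPrime.mem_of_pow_mem inferInstance 2 ((Ideal.unit_mul_mem_iff_mem _ hcu).mp hz'p)
  -- `w₁ ∈ 𝔪_y`: `y` lies on the weak transform of the kept wall
  have hw₁m : w₁ ∈ maximalIdeal (X'.presheaf.stalk y) := by
    have h1 : stalkIdeal (controlledTransform π C W 1) y ≤ maximalIdeal _ :=
      (mem_support_iff_stalkIdeal_le _ _).mp hsat
    exact h1 (by rw [hW']; exact Ideal.mem_span_singleton_self _)
  -- THE JOINT LETTERS `(s, w₁, z')`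
  have hR : IsRsopPart ![s, w₁, z'] := hreg hw₁m hz'm
  have hrs_sw : IsRsopPart ![s, w₁] := isRsopPart_pair_of_triple hR ![0, 1] (by decide)
  -- `v₁` is a UNIT: fullness at `x` transported
  have hv₁u : IsUnit v₁ := by
    have h1 : s ∈ (maximalIdeal (X.presheaf.stalk (π y))).map σ := by
      rw [hEm]; exact Ideal.mem_span_singleton_self s
    rw [← hfull, Ideal.map_span, Set.image_insert_eq, Set.image_insert_eq, Set.image_singleton] at h1
    have h2 : ∃ α β γ : X'.presheaf.stalk y, s = α * σ w + β * σ v + γ * σ z := by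
      rw [Ideal.mem_span_insert] at h1
      obtain ⟨α, r, hr, hαr⟩ := h1
      rw [Ideal.mem_span_pair] at hr
      obtain ⟨β, γ, rfl⟩ := hr
      exact ⟨α, β, γ, by rw [hαr]; ring⟩
    obtain ⟨α, β, γ, h3⟩ := h2
    rw [hww, ← hv₁, hzz'] at h3
    have h4 : s * 1 = s * (α * w₁ + β * v₁ + γ * z') := by
      calc s * 1 = s := mul_one s
        _ = α * (s * w₁) + β * (v₁ * s) + γ * (s * z') := h3
        _ = s * (α * w₁ + β * v₁ + γ * z') := by ring
    have h5 : (1 : X'.presheaf.stalk y) = α * w₁ + β * v₁ + γ * z' :=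
      (mul_cancel_left_mem_nonZeroDivisors hnzd).mp h4
    have h6 : (1 : X'.presheaf.stalk y) ∈ Ideal.span {w₁, β * v₁, z'} := by
      rw [h5]
      refine add_mem (add_mem ?_ ?_) ?_
      · exact Ideal.mul_mem_left _ _ (Ideal.subset_span (by simp))
      · exact Ideal.subset_span (by simp)
      · exact Ideal.mul_mem_left _ _ (Ideal.subset_span (by simp))
    exact isUnit_of_mul_isUnit_right (isUnit_of_one_mem_span_triple h6 hw₁m hz'm)
  -- `e ≥ 2`: at wall exponent 1 the transported cofactor is a unit and the `2`-power form fails (EXIT LEMMA)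
  have hd : 1 ≤ d := by
    by_contra hd0
    have hd0' : d = 0 := by omega
    subst hd0'
    have hg₁u : IsUnit (v₁ * g₁) := by
      have e1 : v₁ * g₁ = σ u * v₁ ^ 2 + (σ a * w₁ * v₁ + σ b * z' * v₁) := by rw [hg₁]; ring
      rw [e1]
      refine isUnit_add_of_mem_maximalIdeal ((hu.map σ).mul (hv₁u.pow 2)) ?_
      exact add_mem (Ideal.mul_mem_right _ _ (Ideal.mul_mem_left _ _ hw₁m))
        (Ideal.mul_mem_right _ _ (Ideal.mul_mem_left _ _ hz'm))
    have hw₀eq : w₀ = σ c * z' ^ 2 + s * w₁ * (v₁ * g₁) := by linear_combination hkey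
    have hmem := hPP.2 hw₀I'
    rw [hw₀eq] at hmem
    exact not_mem_pPowerSpan_of_twoWall_unit 2 hrs_sw hg₁u hz'm hmem
  -- THE TWO-WALL PRESENTATION AT `y` w.r.t. `(w₁, s, z')`, wall exponent `d = e − 1`
  refine ⟨by omega, ?_⟩
  simp only [Nat.add_sub_cancel]
  refine ⟨w₁, s, z', hW', hE, hH', isRsopPart_triple_swap hR, ?_, w₀, hw₀I', σ c, v₁ * g₁, hcu, hkey,
    σ u * v₁ ^ (d + 2), σ a * v₁, σ b * v₁, (hu.map σ).mul (hv₁u.pow _), (ha.map σ).mul hv₁u, hd, ?_⟩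
  · rw [← span_triple_eq_maximalIdeal hR hdim]
    exact congrArg Ideal.span (Set.insert_comm _ _ _)
  · rw [hg₁]; ring

set_option maxHeartbeats 800000 in
/-- **THE EXIT LAW THROUGH ONE POINT BLOW-UP (KERNEL, PROVED; characteristic 2, weight 2, every ring dimension).**
`TwoWallAt 𝓘 W V H e x` and `y` a marked class point over `x` (`𝓘'_y ⊆ 𝔪_y²`, `2`-power form) OFF the weak transform `W'` of
the kept wall ⟹ `e = 1` AND `y` is OFF the weak transform `V'` of the other wall as well: the tower can leave the kept wall
only when the wall clock has run out, and then it leaves BOTH walls (a FREE move).  PROOF: chart round along `(V, H)`: `π^*v =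
s v₁`, `π^*z = s z'`, `π^*w = s w₁` with `w₁` a UNIT (off `W'`); tail `w₀ − π^*c z'² = w₁·s·(v₁ g₁)`, `g₁ = π^*u v₁^e s^{e−1} +
π^*a w₁ + π^*b z'`.  If `v₁ ∈ 𝔪_y` (on `V'`): `g₁ ≡ π^*a w₁` is a unit and `w₀ = π^*c z'² + s v₁·unit` — EXIT LEMMA on the
letters `(s, v₁)`, contradiction.  If `v₁` is a unit and `e ≥ 2`: `g₁ ≡ π^*a w₁` is a unit, `w₀ = π^*c z'² + s·unit` has order 1
(`s ∉ 𝔪_y²`, `point_round_chart_rsop`), contradicting `𝓘'_y ⊆ 𝔪_y²`.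
(Sources: Hauser2010Kangaroo; Matsumura1987, Thms. 14.2–14.3; StacksProject, Tag 0BIQ.) -/
theorem twoWall_point_exit (hπ : IsBlowup π C) [IsLocallyNoetherian X] [IsLocallyNoetherian X']
    (hX : Scheme.IsRegular X) (hCreg : Scheme.IsRegular C.subscheme) (I W V H : X.IdealSheafData) {e : ℕ}
    (y : X') (hcl : IsClosed ({π y} : Set X)) (hpt : (C.support : Set X) = {π y})
    (hIn : stalkIdeal I (π y) ≤ maximalIdeal _ ^ 2)
    (hI'2 : stalkIdeal (controlledTransform π C I 2) y ≤ maximalIdeal _ ^ 2)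
    [CharP (X'.presheaf.stalk y) 2] (hPP : PPowerFormAt 2 (controlledTransform π C I 2) 2 y)
    (h : TwoWallAt I W V H e (π y)) (hfree : y ∉ (controlledTransform π C W 1).support) :
    e = 1 ∧ y ∉ (controlledTransform π C V 1).support := by
  obtain ⟨w, v, z, hWw, hVv, hHz, hrs, -, f, hfI, c, g, hc, hft, u, a, b, hu, ha, he, hg⟩ := h
  obtain ⟨d, rfl⟩ : ∃ d, e = d + 1 := ⟨e - 1, by omega⟩
  haveI : IsRegularLocalRing (X.presheaf.stalk (π y)) := hX _
  have hCst : stalkIdeal C (π y) = maximalIdeal _ := by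
    rw [eq_vanishingIdeal_support_of_isRegular C hCreg]
    apply stalkIdeal_vanishingIdeal_eq_maximalIdeal_of_closure_eq
    rw [hpt, hcl.closure_eq]
  have hrs_vz : IsRsopPart ![v, z] := isRsopPart_pair_of_triple hrs ![1, 2] (by decide)
  have hzm : z ∈ maximalIdeal (X.presheaf.stalk (π y)) := by simpa using hrs.mem_maximalIdeal 2
  have hz2 : z ∉ maximalIdeal (X.presheaf.stalk (π y)) ^ 2 := by simpa using hrs.not_mem_sq 2
  obtain ⟨𝔷, v₁, z', hE, hnzd, hvv, hzz', hV', -, hreg⟩ := point_round_chart_rsop₂ hπ y hCst hrs_vz hVv hHz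
  obtain ⟨𝔷₃, z₃, hE₃, -, hzz₃, -, hreg₃⟩ := point_round_chart_rsop hπ y hCst hzm hz2 hHz
  set σ := (π.stalkMap y).hom with hσ
  set s := σ 𝔷 with hs
  set s₃ := σ 𝔷₃ with hs₃
  have hEm : (maximalIdeal (X.presheaf.stalk (π y))).map σ = Ideal.span {s} := by
    rw [← hCst, ← stalkIdeal_comap_eq_map_stalkMap, hE]
  have hmle : (maximalIdeal (X.presheaf.stalk (π y))).map σ ≤ maximalIdeal (X'.presheaf.stalk y) :=
    Ideal.map_le_iff_le_comap.mpr fun a ha => Ideal.mem_comap.mpr (map_nonunit σ a ha)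
  have hsm : s ∈ maximalIdeal (X'.presheaf.stalk y) := hmle (by rw [hEm]; exact Ideal.mem_span_singleton_self s)
  -- `π^* w = w₁ s` with `w₁` a UNIT: `y` is OFF the weak transform of the kept wall
  have hwm : w ∈ maximalIdeal (X.presheaf.stalk (π y)) := by simpa using hrs.mem_maximalIdeal 0
  have hσw : σ w ∈ Ideal.span {s} := by rw [← hEm]; exact Ideal.mem_map_of_mem _ hwm
  obtain ⟨w₁, hw₁⟩ := Ideal.mem_span_singleton'.mp hσw
  have hw₁u : IsUnit w₁ := by
    by_contra hw
    have hw₁m : w₁ ∈ maximalIdeal _ := (IsLocalRing.mem_maximalIdeal _).mpr (mem_nonunits_iff.mpr hw)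
    apply hfree
    rw [mem_support_iff_stalkIdeal_le, hπ.stalkIdeal_controlledTransform W 1 y, stalkIdeal_comap_eq_map_stalkMap, hE,
      hWw, Ideal.map_span, Set.image_singleton, pow_one, Submodule.colon_span]
    intro q hq
    rw [Submodule.mem_colon_singleton, smul_eq_mul] at hq
    obtain ⟨γ, hγ⟩ := Ideal.mem_span_singleton'.mp hq
    have h1 : s * q = s * (γ * w₁) := by
      calc s * q = q * s := mul_comm _ _
        _ = γ * σ w := hγ.symm
        _ = s * (γ * w₁) := by rw [← hw₁]; ring
    rw [(mul_cancel_left_mem_nonZeroDivisors hnzd).mp h1]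
    exact Ideal.mul_mem_left _ _ hw₁m
  -- `π^* f = w₀ s²`, `w₀ ∈ 𝓘'_y`
  have hσf : σ f ∈ Ideal.span {s ^ 2} := by
    have hm : σ f ∈ (maximalIdeal _ ^ 2).map σ := Ideal.mem_map_of_mem _ (hIn hfI)
    rwa [Ideal.map_pow, hEm, Ideal.span_singleton_pow] at hm
  obtain ⟨w₀, hw₀⟩ := Ideal.mem_span_singleton'.mp hσf
  have hI' : stalkIdeal (controlledTransform π C I 2) y =
      Submodule.colon ((stalkIdeal I (π y)).map σ) {s ^ 2} := by
    rw [hπ.stalkIdeal_controlledTransform I 2 y, stalkIdeal_comap_eq_map_stalkMap, hE,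
      Ideal.span_singleton_pow, Submodule.colon_span]
  have hw₀I' : w₀ ∈ stalkIdeal (controlledTransform π C I 2) y := by
    rw [hI', Submodule.mem_colon_singleton, smul_eq_mul, hw₀]
    exact Ideal.mem_map_of_mem _ hfI
  -- the transported cofactor `π^* g = s · g₁`
  set g₁ : X'.presheaf.stalk y := σ u * v₁ ^ (d + 1) * s ^ d + σ a * w₁ + σ b * z' with hg₁
  have hσg : σ g = s * g₁ := by
    rw [hg]
    simp only [map_add, map_mul, map_pow]
    rw [← hw₁, hvv, hzz', hg₁]
    ring
  -- cancel `s²`: the transported tail is `w₁ · s · (v₁ g₁)`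
  have hkey : w₀ - σ c * z' ^ 2 = w₁ * s * (v₁ * g₁) := by
    have h1 : s ^ 2 * (w₀ - σ c * z' ^ 2) = s ^ 2 * (w₁ * s * (v₁ * g₁)) := by
      have e1 : σ (f - c * z ^ 2) = σ f - σ c * (s * z') ^ 2 := by rw [map_sub, map_mul, map_pow, hzz']
      have e2 : σ (f - c * z ^ 2) = σ w * σ v * σ g := by rw [hft, map_mul, map_mul]
      calc s ^ 2 * (w₀ - σ c * z' ^ 2) = w₀ * s ^ 2 - σ c * (s * z') ^ 2 := by ring
        _ = σ (f - c * z ^ 2) := by rw [e1, hw₀]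
        _ = σ w * σ v * σ g := e2
        _ = (w₁ * s) * (s * v₁) * (s * g₁) := by rw [hw₁, hvv, hσg]
        _ = s ^ 2 * (w₁ * s * (v₁ * g₁)) := by ring
    exact (mul_cancel_left_mem_nonZeroDivisors (pow_mem hnzd 2)).mp h1
  -- `z' ∈ 𝔪_y`
  have hcu : IsUnit (σ c) := hc.map σ
  have hI'1 : stalkIdeal (controlledTransform π C I 2) y ≤ maximalIdeal _ :=
    hI'2.trans (Ideal.pow_le_self (by norm_num))
  have hz'p : σ c * z' ^ 2 ∈ maximalIdeal (X'.presheaf.stalk y) := by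
    have h1 : w₀ - w₁ * s * (v₁ * g₁) ∈ maximalIdeal _ :=
      sub_mem (hI'1 hw₀I') (Ideal.mul_mem_right _ _ (Ideal.mul_mem_left _ _ hsm))
    have e : w₀ - w₁ * s * (v₁ * g₁) = σ c * z' ^ 2 := by rw [← hkey]; ring
    rwa [e] at h1
  have hz'm : z' ∈ maximalIdeal (X'.presheaf.stalk y) :=
    Ideal.IsPrime.mem_of_pow_mem inferInstance 2 ((Ideal.unit_mul_mem_iff_mem _ hcu).mp hz'p)
  -- (i) `y` ON the weak transform of the other wall is IMPOSSIBLE (EXIT LEMMA on `(s, v₁)`)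
  have hv₁u : IsUnit v₁ := by
    by_contra hv
    have hv₁m : v₁ ∈ maximalIdeal _ := (IsLocalRing.mem_maximalIdeal _).mpr (mem_nonunits_iff.mpr hv)
    have hR : IsRsopPart ![s, v₁, z'] := hreg hv₁m hz'm
    have hrs_sv : IsRsopPart ![s, v₁] := isRsopPart_pair_of_triple hR ![0, 1] (by decide)
    have hg₁u : IsUnit (w₁ * g₁) := by
      have e1 : w₁ * g₁ = σ a * w₁ * w₁ + (σ u * v₁ ^ (d + 1) * s ^ d * w₁ + σ b * z' * w₁) := by rw [hg₁]; ring
      rw [e1]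
      refine isUnit_add_of_mem_maximalIdeal (((ha.map σ).mul hw₁u).mul hw₁u) (add_mem ?_ ?_)
      · refine Ideal.mul_mem_right _ _ (Ideal.mul_mem_right _ _ (Ideal.mul_mem_left _ _ ?_))
        rw [pow_succ]
        exact Ideal.mul_mem_left _ _ hv₁m
      · exact Ideal.mul_mem_right _ _ (Ideal.mul_mem_left _ _ hz'm)
    have hw₀eq : w₀ = σ c * z' ^ 2 + s * v₁ * (w₁ * g₁) := by linear_combination hkey
    have hmem := hPP.2 hw₀I'
    rw [hw₀eq] at hmem
    exact not_mem_pPowerSpan_of_twoWall_unit 2 hrs_sv hg₁u hz'm hmem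
  have hVfree : y ∉ (controlledTransform π C V 1).support := by
    intro hmem
    have h1 : stalkIdeal (controlledTransform π C V 1) y ≤ maximalIdeal _ :=
      (mem_support_iff_stalkIdeal_le _ _).mp hmem
    have h2 : v₁ ∈ maximalIdeal _ := h1 (by rw [hV']; exact Ideal.mem_span_singleton_self _)
    exact ((IsLocalRing.mem_maximalIdeal _).mp h2) hv₁u
  -- (ii) off both walls: the wall clock must have run out (`e = 1`), else the order drops
  have hs2 : s ∉ maximalIdeal (X'.presheaf.stalk y) ^ 2 := by
    have hspan : Ideal.span {s₃} = Ideal.span {s} := by rw [← hE₃, hE]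
    obtain ⟨γ, hγ⟩ : ∃ γ, γ * s = s₃ :=
      Ideal.mem_span_singleton'.mp (by rw [← hspan]; exact Ideal.mem_span_singleton_self _)
    obtain ⟨δ, hδ⟩ : ∃ δ, δ * s₃ = s :=
      Ideal.mem_span_singleton'.mp (by rw [hspan]; exact Ideal.mem_span_singleton_self _)
    have hγδ : δ * γ = 1 := by
      have h1 : s * (δ * γ) = s * 1 := by
        calc s * (δ * γ) = δ * (γ * s) := by ring
          _ = s * 1 := by rw [hγ, hδ, mul_one]
      exact (mul_cancel_left_mem_nonZeroDivisors hnzd).mp h1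
    have hz₃ : z₃ = δ * z' := by
      have h1 : s * z₃ = s * (δ * z') := by
        calc s * z₃ = (δ * γ) * (s * z₃) := by rw [hγδ, one_mul]
          _ = δ * (s₃ * z₃) := by rw [← hγ]; ring
          _ = δ * σ z := by rw [← hzz₃]
          _ = s * (δ * z') := by rw [hzz']; ring
      exact (mul_cancel_left_mem_nonZeroDivisors hnzd).mp h1
    have hz₃m : z₃ ∈ maximalIdeal _ := by rw [hz₃]; exact Ideal.mul_mem_left _ _ hz'm
    have h3 : s₃ ∉ maximalIdeal _ ^ 2 := by simpa using (hreg₃ hz₃m).2.2.2.not_mem_sq 0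
    intro hs
    exact h3 (by rw [← hγ]; exact Ideal.mul_mem_left _ _ hs)
  have hd : d = 0 := by
    by_contra hd0
    have hg₁u : IsUnit g₁ := by
      have e1 : g₁ = σ a * w₁ + (σ u * v₁ ^ (d + 1) * s ^ d + σ b * z') := by rw [hg₁]; ring
      rw [e1]
      refine isUnit_add_of_mem_maximalIdeal ((ha.map σ).mul hw₁u) (add_mem ?_ ?_)
      · refine Ideal.mul_mem_left _ _ ?_
        rw [show d = (d - 1) + 1 by omega, pow_succ]
        exact Ideal.mul_mem_left _ _ hsm
      · exact Ideal.mul_mem_left _ _ hz'm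
    have hU : IsUnit (w₁ * (v₁ * g₁)) := hw₁u.mul (hv₁u.mul hg₁u)
    have h1 : s * (w₁ * (v₁ * g₁)) ∈ maximalIdeal (X'.presheaf.stalk y) ^ 2 := by
      have e1 : s * (w₁ * (v₁ * g₁)) = w₀ - σ c * z' ^ 2 := by rw [hkey]; ring
      rw [e1]
      exact sub_mem (hI'2 hw₀I') (Ideal.mul_mem_left _ _ (Ideal.pow_mem_pow hz'm 2))
    have h2 : (w₁ * (v₁ * g₁)) * s ∈ maximalIdeal (X'.presheaf.stalk y) ^ 2 := by rw [mul_comm]; exact h1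
    exact hs2 ((Ideal.unit_mul_mem_iff_mem _ hU).mp h2)
  exact ⟨by omega, hVfree⟩

end WallTransport

end Summit.ResolutionOfSingularities.ResolutionOfSingularities.Theorems.HugValuationCut
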